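import Literature.Probability.RandomPlanarGeometry.Curve
import Literature.Probability.RandomPlanarGeometry.PlanarDomains
import Mathlib.Topology.Connected.Basic
import Mathlib.Topology.Order.IntermediateValue
import Mathlib.Topology.Order.Compact
import Mathlib.Topology.UnitInterval
import HarnessLib

/-!
# Sub-arc — support file for `stub_subArc`
(line `slit-continuous-restriction` of the crux `SAWLoopFugacityFlow.SimpleSubseqLimits`,
stmt-CriticalPhenomena-4982; registered skeleton
`Summits/CriticalPhenomena/SAWScalingLimit/Cruxes/SimpleSubseqLimits/Lines/slit_continuous_restriction.lean`)

Planar-arc topology of truncations. If the RANGE of a curve `γ` is a simple arc `e : I → ℂ`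
(continuous, injective) from `a = e 0 = γ 0 = D.pt 0` to `b = e 1 = D.pt 1`, meeting `∂D` only in
`{a, b}`, then the truncation `π := truncate γ w` (`π s = γ (w s)`) cut before the curve visits `b`
has as range the initial sub-arc `e [0, m]`, `0 < m < 1`: `S := range π` is a connected compact subset
of the arc containing the endpoint `a`, so `J := e ⁻¹' S` is a closed connected subset of `I`
containing `0` (`IsPreconnected.preimage_of_isClosedMap`: `e` is a closed injective map), i.e. the
initial segment `[0, m]` with `m` its greatest element; `m < 1` because `b ∉ S`, `0 < m` because the
tip `γ w ≠ a` lies in `S`. The rescaled arc `u ↦ e (m u)` is then injective with range `S`, starts at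
`a` and meets `∂D` only at the parameter `0`.

* `truncate_apply` — `truncate γ w s = γ (w * s)` (product of `unitInterval`);
* `stub_subArc : SubArc` — the registered stub.

No named facts (elementary point-set topology of `unitInterval`).
-/

noncomputable section

open Filter Topology Set Metric Function
open Literature.Probability.RandomPlanarGeometry
open scoped unitInterval

namespace Summit.CriticalPhenomena.SAWScalingLimit.Theorems.SimpleSubseqLimits.SlitRestriction.Arc

/-! ## Vocabulary (verbatim from the line skeleton) -/

/-- **Admissible limit past** at the entrance ball `B̄(q, ρ)` of the Dobrushin domain `D`: the tip `π 1`
lies in the closed entrance ball, the range lies in `cl D`, and the RANGE is a simple arc from the root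
`a = D.pt 0` meeting `∂D` only at the root (so it misses the target `b` and does not separate `D`). By SHAPE
(`PastShadowing.Main.rangeArc_of_avoidanceValues`) and the off-target restriction this is ν-a.s. the form of a
first-entrance past of a subsequential limit; the curve `π` itself may fold. [folklore] -/
def IsAdmissiblePast (D : DobrushinDomain) (π : Curve ℂ) (q : ℂ) (ρ : ℝ) : Prop :=
  π 1 ∈ closedBall q ρ ∧ Set.range (fun u : I => π u) ⊆ closure D.carrier ∧
    ∃ e : C(I, ℂ), Injective e ∧ Set.range e = Set.range (fun u : I => π u) ∧ e 0 = D.pt 0 ∧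
      ∀ u : I, e u ∈ frontier D.carrier → u = 0

/-- The **truncation** (past) of a curve at the parameter `w`, rescaled to `[0, 1]`: `s ↦ γ (w s)`.
[folklore] -/
def truncate (γ : Curve ℂ) (w : I) : Curve ℂ :=
  ⟨⟨fun s : I => γ ⟨(w : ℝ) * s, unitInterval.mul_mem w.2 s.2⟩,
    γ.continuous.comp ((continuous_const.mul continuous_subtype_val).subtype_mk _)⟩⟩

/-- Pointwise formula for the truncation: `truncate γ w s = γ (w * s)`, the product taken in the
monoid `unitInterval`. [folklore] -/
@[simp] theorem truncate_apply (γ : Curve ℂ) (w s : I) : truncate γ w s = γ (w * s) := rfl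

/-! ## The registered stub -/

/-- **SUB-ARC** (helper statement of the transfer; planar-arc topology): if the range of `γ` is a simple
arc from `a = γ 0 = D.pt 0` to `b = D.pt 1` meeting `∂D` only at `a, b` and lying in `cl D`, then every
truncation `γ|[0, w]` whose tip lies in `B̄(q, ρ)`, is not the root, and which has not visited `b`, is
an admissible past at `B̄(q, ρ)`: its range is the initial sub-arc `e [0, m]`, `0 < m < 1` (a connected
compact subset of an arc containing an endpoint is an initial segment). Registered stub statement of
crux stmt-CriticalPhenomena-4982 (line slit-continuous-restriction), body verbatim from the line
skeleton `Cruxes/SimpleSubseqLimits/Lines/slit_continuous_restriction.lean`; a helper statement of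
this line, not a literature fact, hence untagged and declared here; proved below (`stub_subArc`). -/
def SubArc : Prop :=
  ∀ (D : DobrushinDomain) (γ : Curve ℂ) (w : I) (q : ℂ) (ρ : ℝ),
    (∃ e : C(I, ℂ), Injective e ∧ Set.range e = Set.range (fun u : I => γ u) ∧
        e 0 = D.pt 0 ∧ e 1 = D.pt 1) →
    Set.range (fun u : I => γ u) ∩ frontier D.carrier ⊆ {D.pt 0, D.pt 1} →
    γ 0 = D.pt 0 → Set.range (fun u : I => γ u) ⊆ closure D.carrier →
    γ w ∈ closedBall q ρ → γ w ≠ D.pt 0 → (∀ u : I, u ≤ w → γ u ≠ D.pt 1) →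
    IsAdmissiblePast D (truncate γ w) q ρ

/-- **Initial segments of an arc.** If `e : I → ℂ` is continuous and injective and `S ⊆ range e` is a
closed preconnected set containing `e 0`, then `e ⁻¹' S = [0, m]` for the greatest parameter `m`
with `e m ∈ S`. [folklore] -/
theorem exists_preimage_eq_Icc (e : C(I, ℂ)) (he : Injective e) {S : Set ℂ} (hS : IsPreconnected S)
    (hSc : IsClosed S) (hSe : S ⊆ Set.range e) (h0 : e 0 ∈ S) :
    ∃ m : I, e m ∈ S ∧ ∀ u : I, e u ∈ S ↔ u ≤ m := by
  have hJ : IsPreconnected (e ⁻¹' S) :=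
    hS.preimage_of_isClosedMap he e.continuous.isClosedMap hSe
  have hJc : IsCompact (e ⁻¹' S) := (hSc.preimage e.continuous).isCompact
  obtain ⟨m, hmJ, hm⟩ := hJc.exists_isGreatest ⟨0, h0⟩
  refine ⟨m, hmJ, fun u => ⟨fun hu => hm hu, fun hu => ?_⟩⟩
  exact hJ.Icc_subset (a := 0) h0 hmJ ⟨unitInterval.nonneg', hu⟩

/-- **stub 2d — SUB-ARC**: the truncation of a curve whose range is a simple arc `a → b` in `cl D`
meeting `∂D` only at `a, b`, cut at a parameter `w` with `γ w ∈ B̄(q, ρ)`, `γ w ≠ a` and `b` not yet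
visited, is an admissible past: its range is the initial sub-arc `e [0, m]`, `0 < m < 1`, reparametrised
as `u ↦ e (m u)`. [folklore] -/
theorem stub_subArc : SubArc := by
  rintro D γ w q ρ ⟨e, he, hrange, he0, he1⟩ hfr hγ0 hcl hw hw0 hw1
  -- the range `S` of the truncation: a closed connected subset of the arc `range e = range γ`
  set π : Curve ℂ := truncate γ w with hπ
  have hπ1 : π 1 = γ w := by rw [hπ, truncate_apply, mul_one]
  have hπ0 : π 0 = e 0 := by rw [hπ, truncate_apply, mul_zero, hγ0, he0]
  have hSγ : Set.range (fun u : I => π u) ⊆ Set.range (fun u : I => γ u) := by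
    rintro _ ⟨s, rfl⟩
    exact ⟨w * s, rfl⟩
  have hSe : Set.range (fun u : I => π u) ⊆ Set.range e := hrange ▸ hSγ
  have hS : IsPreconnected (Set.range (fun u : I => π u)) := isPreconnected_range π.continuous
  have hSc : IsClosed (Set.range (fun u : I => π u)) := (isCompact_range π.continuous).isClosed
  obtain ⟨m, hmS, hJ⟩ := exists_preimage_eq_Icc e he hS hSc hSe (hπ0 ▸ ⟨0, rfl⟩)
  -- `m < 1`: the target `b = e 1` is not on the truncation
  have hm1 : m < 1 := by
    refine lt_of_le_of_ne unitInterval.le_one' fun h => ?_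
    obtain ⟨s, hs⟩ := h ▸ hmS
    exact hw1 (w * s) unitInterval.mul_le_left (hs.trans he1)
  -- `0 < m`: the tip `γ w ≠ a = e 0` is on the truncation
  have hm0 : m ≠ 0 := by
    intro h
    obtain ⟨v, hv⟩ := hSe ⟨1, rfl⟩
    have hvS : e v ∈ Set.range (fun u : I => π u) := hv ▸ ⟨1, rfl⟩
    have hv0 : v = 0 := le_antisymm (h ▸ (hJ v).1 hvS) unitInterval.nonneg'
    exact hw0 (hπ1 ▸ hv.symm.trans (hv0.symm ▸ he0))
  have hm0' : (m : ℝ) ≠ 0 := unitInterval.coe_ne_zero.2 hm0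
  -- the rescaled initial sub-arc `u ↦ e (m u)`
  let e' : C(I, ℂ) := ⟨fun u : I => e ⟨(m : ℝ) * u, unitInterval.mul_mem m.2 u.2⟩,
    e.continuous.comp ((continuous_const.mul continuous_subtype_val).subtype_mk _)⟩
  have he' : ∀ u : I, e' u = e (m * u) := fun u => rfl
  refine ⟨hπ1.symm ▸ hw, hSγ.trans hcl, e', fun u v huv => ?_, ?_, ?_, fun u hu => ?_⟩
  · -- injective
    rw [he', he'] at huv
    exact mul_left_cancel₀ hm0 (he huv)
  · -- range
    refine Set.Subset.antisymm ?_ fun x hx => ?_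
    · rintro _ ⟨u, rfl⟩
      exact (hJ (m * u)).2 unitInterval.mul_le_left
    · obtain ⟨v, rfl⟩ := hSe hx
      have hvm : v ≤ m := (hJ v).1 hx
      refine ⟨⟨(v : ℝ) / m, unitInterval.div_mem (unitInterval.nonneg v) (unitInterval.nonneg m)
        (Subtype.coe_le_coe.2 hvm)⟩, ?_⟩
      change e _ = e v
      congr 1
      exact Subtype.ext (mul_div_cancel₀ (v : ℝ) hm0')
  · -- root
    rw [he', mul_zero, he0]
  · -- the sub-arc meets the frontier only at the root
    have hmem : e (m * u) ∈ Set.range (fun u : I => γ u) ∩ frontier D.carrier :=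
      ⟨hSγ ((hJ (m * u)).2 unitInterval.mul_le_left), hu⟩
    rcases hfr hmem with h | h
    · have h0 : m * u = 0 := he (h.trans he0.symm)
      exact (mul_eq_zero.1 h0).resolve_left hm0
    · have h1 : m * u = 1 := he (h.trans he1.symm)
      exact absurd (h1 ▸ (unitInterval.mul_le_left : m * u ≤ m)) (not_le.2 hm1)

end Summit.CriticalPhenomena.SAWScalingLimit.Theorems.SimpleSubseqLimits.SlitRestriction.Arc

end
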